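import Literature.NumberTheory.LFunctions.MollifiedZetaConvexity
import HarnessLib

/-!
# The two end-point mean squares of the convexity argument: `J(3) ≪ V/X` and `J(1/2) ≪ V log T/log X`

Topic `Literature/NumberTheory/LFunctions`. Everything in this file is PROVED (no definitions, no
named facts).

For `G = G_{X,T₀,V}` of `Literature.NumberTheory.LFunctions.TwistedMoment.zetaMollifierG`
(`= (s−1)(ζψ_X − 1)/(s+1) · exp(((s − 1/2 − iT₀)/V)²)`) and `J(σ) = ∫ |G(σ+it)|² dt`:

* `Literature.NumberTheory.LFunctions.TwistedMoment.meanSquare_zetaMollifierG_three_le` — on the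
  line `σ = 3` the power saving `|ζψ_X − 1| ≤ 2X^{-1/2}`
  (`Literature.NumberTheory.LFunctions.TwistedMoment.norm_zeta_mul_plateauMollifier_sub_one_le`)
  gives `J(3) ≤ 25 V/X` (`X ≥ 4`, `V ≥ 3`).

(The companion bound for `J(1/2)` from the mollified mean square is in the sequel file.)

## References

* E. C. Titchmarsh, *The Theory of the Riemann Zeta-Function*, 2nd ed. (1986), §9.24.
  [cite: Titchmarsh1986, §9.24]
* A. Selberg, *Contributions to the theory of the Riemann zeta-function* (1946), §4.
-/

noncomputable section

open Complex Real MeasureTheory Set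
open Literature.Analysis.Complex (integrable_exp_neg_sq_div integral_exp_neg_sq_div)

namespace Literature.NumberTheory.LFunctions.TwistedMoment

/-! ### Numerical constants -/

/-- `e^{1/2} ≤ 1.65`. [folklore] -/
theorem exp_half_le : Real.exp (1 / 2) ≤ 1.65 := by
  have h : Real.exp (1 / 2) ^ 2 = Real.exp 1 := by rw [← Real.exp_nat_mul]; norm_num
  have he := Real.exp_one_lt_d9
  nlinarith [Real.exp_pos (1 / 2 : ℝ)]

/-- `e^{3/2} ≤ 4.49`. [folklore] -/
theorem exp_three_halves_le : Real.exp (3 / 2) ≤ 4.49 := by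
  have h : Real.exp (3 / 2) = Real.exp 1 * Real.exp (1 / 2) := by rw [← Real.exp_add]; norm_num
  rw [h]
  have he := Real.exp_one_lt_d9
  have hh := exp_half_le
  nlinarith [Real.exp_pos (1 / 2 : ℝ), Real.exp_pos (1 : ℝ)]

/-- `√(π/2) ≤ 1.26` and `√π ≤ 1.78`. [folklore] -/
theorem sqrt_pi_half_le : Real.sqrt (π / 2) ≤ 1.26 ∧ Real.sqrt π ≤ 1.78 := by
  constructor
  · rw [Real.sqrt_le_left (by norm_num)]; nlinarith [Real.pi_lt_d4]
  · rw [Real.sqrt_le_left (by norm_num)]; nlinarith [Real.pi_lt_d4]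

/-! ### `J(3) ≪ V/X` -/

/-- `|(s−1)/(s+1)| ≤ 1` for `Re s ≥ 0`. [folklore] -/
theorem norm_sub_one_div_add_one_le {s : ℂ} (hs : 0 ≤ s.re) : ‖(s - 1) / (s + 1)‖ ≤ 1 := by
  have hs1 : s + 1 ≠ 0 := by
    intro h; have := congrArg Complex.re h; simp at this; linarith
  rw [norm_div, div_le_one (norm_pos_iff.2 hs1)]
  have h1 : ‖s - 1‖ ^ 2 ≤ ‖s + 1‖ ^ 2 := by
    rw [Complex.sq_norm, Complex.sq_norm, Complex.normSq_apply, Complex.normSq_apply]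
    simp; nlinarith
  exact (pow_le_pow_iff_left₀ (norm_nonneg _) (norm_nonneg _) two_ne_zero).1 h1

/-- **`J(3) ≤ 25 V/X`**: on `σ = 3`, `|G|² ≤ (2X^{-1/2})² e^{2·(5/2)²/V²} e^{-2(t−T₀)²/V²}` and
`∫ e^{-2(t−T₀)²/V²} dt = V (π/2)^{1/2}`. [cite: Titchmarsh1986, §9.24] -/
theorem meanSquare_zetaMollifierG_three_le {X T₀ V : ℝ} (hX : 4 ≤ X) (hV : 3 ≤ V) :
    ∫ y : ℝ, ‖zetaMollifierG X T₀ V ((3 : ℝ) + y * I)‖ ^ 2 ≤ 25 * V / X := by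
  have hV0 : 0 < V := by linarith
  have hX0 : 0 < X := by linarith
  have hk : (0 : ℝ) < V ^ 2 / 2 := by positivity
  -- pointwise bound
  have hpt : ∀ y : ℝ, ‖zetaMollifierG X T₀ V ((3 : ℝ) + y * I)‖ ^ 2 ≤
      (4 * 4.49 / X) * Real.exp (-(y - T₀) ^ 2 / (V ^ 2 / 2)) := by
    intro y
    set s : ℂ := (3 : ℝ) + y * I with hs
    have hs1 : s ≠ 1 := by
      intro h; have := congrArg Complex.re h; simp [hs] at this
    have hsre : s.re = 3 := by simp [hs]
    have hsim : s.im = y := by simp [hs]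
    rw [zetaMollifierG_eq hs1, norm_mul, norm_mul]
    have h1 : ‖(s - 1) / (s + 1)‖ ≤ 1 := norm_sub_one_div_add_one_le (by rw [hsre]; norm_num)
    have h2 : ‖riemannZeta s * plateauMollifier X s - 1‖ ≤ 2 * X ^ (-(1 / 2 : ℝ)) :=
      norm_zeta_mul_plateauMollifier_sub_one_le hX (by rw [hsre])
    have h3 : ‖cexp (((s - 1 / 2 - T₀ * I) / V) ^ 2)‖ = Real.exp (((3 - 1 / 2) ^ 2 - (y - T₀) ^ 2) / V ^ 2) := by
      rw [norm_cexp_gaussFactor T₀ hV0 s, hsre, hsim]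
    rw [h3]
    have h12 : ‖(s - 1) / (s + 1)‖ * ‖riemannZeta s * plateauMollifier X s - 1‖ ≤ 2 * X ^ (-(1 / 2 : ℝ)) := by
      calc ‖(s - 1) / (s + 1)‖ * ‖riemannZeta s * plateauMollifier X s - 1‖ ≤ 1 * (2 * X ^ (-(1 / 2 : ℝ))) :=
            mul_le_mul h1 h2 (norm_nonneg _) zero_le_one
        _ = _ := one_mul _
    have hsq : (2 * X ^ (-(1 / 2 : ℝ))) ^ 2 = 4 / X := by
      have : (X ^ (-(1 / 2 : ℝ))) ^ 2 = X⁻¹ := by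
        rw [← Real.rpow_natCast, ← Real.rpow_mul hX0.le]; norm_num
        exact Real.rpow_neg_one X
      rw [mul_pow, this]; ring
    -- the exponential squared
    have hexp : Real.exp (((3 - 1 / 2) ^ 2 - (y - T₀) ^ 2) / V ^ 2) ^ 2 ≤
        4.49 * Real.exp (-(y - T₀) ^ 2 / (V ^ 2 / 2)) := by
      rw [← Real.exp_nat_mul]
      have e1 : ((2 : ℕ) : ℝ) * (((3 - 1 / 2) ^ 2 - (y - T₀) ^ 2) / V ^ 2) =
          (25 / 2) / V ^ 2 + -(y - T₀) ^ 2 / (V ^ 2 / 2) := by push_cast; field_simp; ring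
      rw [e1, Real.exp_add]
      refine mul_le_mul_of_nonneg_right ?_ (Real.exp_pos _).le
      have hle : (25 / 2) / V ^ 2 ≤ 3 / 2 := by
        rw [div_le_iff₀ (by positivity)]; nlinarith
      exact (Real.exp_le_exp.2 hle).trans exp_three_halves_le
    have h0 : 0 ≤ ‖(s - 1) / (s + 1)‖ * ‖riemannZeta s * plateauMollifier X s - 1‖ := by positivity
    calc (‖(s - 1) / (s + 1)‖ * ‖riemannZeta s * plateauMollifier X s - 1‖ *
          Real.exp (((3 - 1 / 2) ^ 2 - (y - T₀) ^ 2) / V ^ 2)) ^ 2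
        = (‖(s - 1) / (s + 1)‖ * ‖riemannZeta s * plateauMollifier X s - 1‖) ^ 2 *
          Real.exp (((3 - 1 / 2) ^ 2 - (y - T₀) ^ 2) / V ^ 2) ^ 2 := by ring
      _ ≤ (2 * X ^ (-(1 / 2 : ℝ))) ^ 2 * (4.49 * Real.exp (-(y - T₀) ^ 2 / (V ^ 2 / 2))) := by
          refine mul_le_mul (pow_le_pow_left₀ h0 h12 2) hexp (by positivity) (by positivity)
      _ = (4 * 4.49 / X) * Real.exp (-(y - T₀) ^ 2 / (V ^ 2 / 2)) := by rw [hsq]; ring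
  -- integrate
  have hint : Integrable fun y : ℝ => (4 * 4.49 / X) * Real.exp (-(y - T₀) ^ 2 / (V ^ 2 / 2)) :=
    (integrable_exp_neg_sq_div (c := T₀) hk).const_mul _
  have hmeas : AEStronglyMeasurable (fun y : ℝ => ‖zetaMollifierG X T₀ V ((3 : ℝ) + y * I)‖ ^ 2) volume := by
    have hc : Continuous fun y : ℝ => zetaMollifierG X T₀ V ((3 : ℝ) + y * I) := by
      refine (differentiableOn_zetaMollifierG X T₀ V).continuousOn.comp_continuous
        (continuous_const.add (Complex.continuous_ofReal.mul continuous_const)) fun y => ?_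
      simp only [Set.mem_setOf_eq]; simp; norm_num
    exact ((hc.norm).pow 2).aestronglyMeasurable
  have hintG : Integrable fun y : ℝ => ‖zetaMollifierG X T₀ V ((3 : ℝ) + y * I)‖ ^ 2 :=
    hint.mono' hmeas (ae_of_all _ fun y => by
      rw [Real.norm_eq_abs, abs_of_nonneg (by positivity)]; exact hpt y)
  calc ∫ y : ℝ, ‖zetaMollifierG X T₀ V ((3 : ℝ) + y * I)‖ ^ 2
      ≤ ∫ y : ℝ, (4 * 4.49 / X) * Real.exp (-(y - T₀) ^ 2 / (V ^ 2 / 2)) :=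
        integral_mono hintG hint hpt
    _ = (4 * 4.49 / X) * Real.sqrt (π * (V ^ 2 / 2)) := by
        rw [MeasureTheory.integral_const_mul, integral_exp_neg_sq_div hk]
    _ ≤ 25 * V / X := by
        have hs : Real.sqrt (π * (V ^ 2 / 2)) = V * Real.sqrt (π / 2) := by
          rw [show π * (V ^ 2 / 2) = V ^ 2 * (π / 2) by ring, Real.sqrt_mul (sq_nonneg V),
            Real.sqrt_sq hV0.le]
        rw [hs]
        have h := sqrt_pi_half_le.1
        rw [div_mul_eq_mul_div, div_le_div_iff₀ hX0 hX0]
        have : 0 ≤ Real.sqrt (π / 2) := Real.sqrt_nonneg _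
        nlinarith [mul_le_mul_of_nonneg_left h (by positivity : 0 ≤ V * X)]

/-! ### `J(1/2)`: pointwise bounds on the critical line -/

/-- `|ζ(1/2+iy)| ≤ (3 + |y|)³` (Euler–Maclaurin bound of the tree). [folklore] -/
theorem norm_zeta_half_le (y : ℝ) : ‖riemannZeta (1 / 2 + y * I)‖ ≤ (3 + |y|) ^ 3 := by
  set s : ℂ := 1 / 2 + y * I with hs
  have hs1 : s ≠ 1 := by intro h; have := congrArg Complex.re h; simp [hs] at this
  have hre : s.re = 1 / 2 := by simp [hs]
  have h := Literature.NumberTheory.LFunctions.norm_riemannZeta_le_of_neg_one_le_re (s := s) (by rw [hre]; norm_num) hs1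
  have hn : ‖s‖ ≤ 1 / 2 + |y| := by
    refine (Complex.norm_le_abs_re_add_abs_im s).trans ?_
    simp [hs]
  have hs1n : 1 / 2 ≤ ‖s - 1‖ := by
    have := abs_re_le_norm (s - 1); simp [hs] at this; norm_num at this
    exact this
  have h1 : 1 / ‖s - 1‖ ≤ 2 := by rw [div_le_iff₀ (by linarith)]; linarith
  have h2 : ‖s + 1‖ ≤ 3 / 2 + |y| := (norm_add_le _ _).trans (by simp; linarith)
  have h3 : ‖s + 2‖ ≤ 5 / 2 + |y| := (norm_add_le _ _).trans (by simp; linarith)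
  set a := |y| with ha
  have ha0 : 0 ≤ a := abs_nonneg y
  calc ‖riemannZeta s‖ ≤ 1 / ‖s - 1‖ + 1 / 2 + ‖s‖ / 12 + ‖s‖ * ‖s + 1‖ * ‖s + 2‖ / 48 := h
    _ ≤ 2 + 1 / 2 + (1 / 2 + a) / 12 + (1 / 2 + a) * (3 / 2 + a) * (5 / 2 + a) / 48 := by
        gcongr
    _ ≤ (3 + a) ^ 3 := by nlinarith [sq_nonneg a, mul_nonneg ha0 (sq_nonneg a)]

/-- `(1 + |w|)⁶ e^{-w²/(2V²)} ≤ 1568 (1 + V)⁶` (`V > 0`). [folklore] -/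
theorem one_add_abs_pow_six_mul_exp_le {w V : ℝ} (hV : 0 < V) :
    (1 + |w|) ^ 6 * Real.exp (-(w ^ 2) / (2 * V ^ 2)) ≤ 1568 * (1 + V) ^ 6 := by
  set y := |w| / V with hy
  have hy0 : 0 ≤ y := by positivity
  have hw : |w| = V * y := by rw [hy]; field_simp
  have h1 : 1 + |w| ≤ (1 + V) * (1 + y) := by rw [hw]; nlinarith
  have h2 : (1 + |w|) ^ 6 ≤ (1 + V) ^ 6 * (1 + y) ^ 6 := by
    rw [← mul_pow]; exact pow_le_pow_left₀ (by positivity) h1 6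
  have h3 : (1 + y) ^ 6 ≤ 32 * (1 + y ^ 6) := by
    nlinarith [sq_nonneg (y - 1), sq_nonneg (y + 1), sq_nonneg y, sq_nonneg (y ^ 2 - 1),
      sq_nonneg (y ^ 3 - 1), sq_nonneg (y ^ 3 - y), mul_nonneg hy0 (sq_nonneg (y - 1)),
      mul_nonneg hy0 (sq_nonneg (y^2 - 1)), pow_nonneg hy0 3, pow_nonneg hy0 4, pow_nonneg hy0 5]
  have hexp : Real.exp (-(w ^ 2) / (2 * V ^ 2)) = Real.exp (-(y ^ 2) / 2) := by
    congr 1; rw [hy, div_pow, sq_abs]; field_simp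
  rw [hexp]
  -- `y⁶ e^{-y²/2} ≤ 48`
  have h4 : y ^ 6 * Real.exp (-(y ^ 2) / 2) ≤ 48 := by
    have h := Real.pow_div_factorial_le_exp (y ^ 2 / 2) (by positivity) 3
    rw [show Nat.factorial 3 = 6 by rfl] at h
    have e : (y ^ 2 / 2) ^ 3 / (6 : ℕ) = y ^ 6 / 48 := by push_cast; ring
    rw [e] at h
    have hpos : 0 < Real.exp (y ^ 2 / 2) := Real.exp_pos _
    rw [show -(y ^ 2) / 2 = -(y ^ 2 / 2) by ring, Real.exp_neg, ← div_eq_mul_inv, div_le_iff₀ hpos]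
    linarith
  have hexp1 : Real.exp (-(y ^ 2) / 2) ≤ 1 := by
    rw [Real.exp_le_one_iff]; have : 0 ≤ y ^ 2 := sq_nonneg y; linarith
  have hexp0 : 0 ≤ Real.exp (-(y ^ 2) / 2) := (Real.exp_pos _).le
  calc (1 + |w|) ^ 6 * Real.exp (-(y ^ 2) / 2) ≤ ((1 + V) ^ 6 * (32 * (1 + y ^ 6))) * Real.exp (-(y ^ 2) / 2) :=
        mul_le_mul_of_nonneg_right (h2.trans (mul_le_mul_of_nonneg_left h3 (by positivity))) hexp0
    _ = 32 * (1 + V) ^ 6 * (Real.exp (-(y ^ 2) / 2) + y ^ 6 * Real.exp (-(y ^ 2) / 2)) := by ring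
    _ ≤ 32 * (1 + V) ^ 6 * (1 + 48) := by gcongr
    _ = 1568 * (1 + V) ^ 6 := by ring

/-- The critical-line bound: `‖G(1/2+iy)‖² ≤ 2 (Z(y)² |ψ_X(1/2+iy)|² + 1) e^{-2(y−T₀)²/V²}`. [cite: Titchmarsh1986, §9.24] -/
theorem norm_sq_zetaMollifierG_half_le {X T₀ V : ℝ} (hV : 0 < V) (y : ℝ) :
    ‖zetaMollifierG X T₀ V ((1 / 2 : ℝ) + y * I)‖ ^ 2 ≤
      2 * ((hardyZ y) ^ 2 * ‖plateauMollifier X (1 / 2 + y * I)‖ ^ 2 + 1) *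
        Real.exp (-(y - T₀) ^ 2 / (V ^ 2 / 2)) := by
  set s : ℂ := ((1 / 2 : ℝ) : ℂ) + y * I with hs
  have hs' : s = 1 / 2 + y * I := by rw [hs]; push_cast; ring
  have hs1 : s ≠ 1 := by intro h; have := congrArg Complex.re h; simp [hs] at this
  have hsre : s.re = 1 / 2 := by simp [hs]
  have hsim : s.im = y := by simp [hs]
  rw [zetaMollifierG_eq hs1, norm_mul, norm_mul, norm_cexp_gaussFactor T₀ hV s, hsre, hsim]
  have h1 : ‖(s - 1) / (s + 1)‖ ≤ 1 := norm_sub_one_div_add_one_le (by rw [hsre]; norm_num)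
  have hZ : ‖riemannZeta s‖ = |hardyZ y| := by
    rw [hs']; exact (abs_hardyZ_eq_norm_riemannZeta_holds y).symm
  have h2 : ‖riemannZeta s * plateauMollifier X s - 1‖ ≤ |hardyZ y| * ‖plateauMollifier X (1 / 2 + y * I)‖ + 1 := by
    refine (norm_sub_le _ _).trans ?_
    rw [norm_mul, hZ, norm_one, hs']
  set P := |hardyZ y| * ‖plateauMollifier X (1 / 2 + y * I)‖ with hP
  have hP0 : 0 ≤ P := by positivity
  have hexp : Real.exp (((1 / 2 - 1 / 2 : ℝ) ^ 2 - (y - T₀) ^ 2) / V ^ 2) ^ 2 = Real.exp (-(y - T₀) ^ 2 / (V ^ 2 / 2)) := by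
    rw [← Real.exp_nat_mul]; congr 1; push_cast; field_simp; ring
  have h12 : ‖(s - 1) / (s + 1)‖ * ‖riemannZeta s * plateauMollifier X s - 1‖ ≤ P + 1 := by
    calc ‖(s - 1) / (s + 1)‖ * ‖riemannZeta s * plateauMollifier X s - 1‖ ≤ 1 * (P + 1) :=
          mul_le_mul h1 h2 (norm_nonneg _) zero_le_one
      _ = P + 1 := one_mul _
  have h0 : 0 ≤ ‖(s - 1) / (s + 1)‖ * ‖riemannZeta s * plateauMollifier X s - 1‖ := by positivity
  have hsqP : (P + 1) ^ 2 ≤ 2 * (hardyZ y ^ 2 * ‖plateauMollifier X (1 / 2 + y * I)‖ ^ 2 + 1) := by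
    have : P ^ 2 = hardyZ y ^ 2 * ‖plateauMollifier X (1 / 2 + y * I)‖ ^ 2 := by
      rw [hP, mul_pow, sq_abs]
    nlinarith [sq_nonneg (P - 1)]
  calc (‖(s - 1) / (s + 1)‖ * ‖riemannZeta s * plateauMollifier X s - 1‖ *
        Real.exp (((1 / 2 - 1 / 2 : ℝ) ^ 2 - (y - T₀) ^ 2) / V ^ 2)) ^ 2
      = (‖(s - 1) / (s + 1)‖ * ‖riemannZeta s * plateauMollifier X s - 1‖) ^ 2 *
          Real.exp (((1 / 2 - 1 / 2 : ℝ) ^ 2 - (y - T₀) ^ 2) / V ^ 2) ^ 2 := by ring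
    _ ≤ (P + 1) ^ 2 * Real.exp (-(y - T₀) ^ 2 / (V ^ 2 / 2)) := by
        rw [hexp]; exact mul_le_mul_of_nonneg_right (pow_le_pow_left₀ h0 h12 2) (Real.exp_pos _).le
    _ ≤ _ := mul_le_mul_of_nonneg_right hsqP (Real.exp_pos _).le

/-- The far-field majorant: for `|y − T₀| > R ≥ T₀/4 > 0` and `X ≥ 0`,
`Z(y)²|ψ_X|² e^{-2(y−T₀)²/V²} ≤ 10⁸ X (1+V)⁶ e^{-R²/V²} · e^{-(y−T₀)²/(2V²)}`. [folklore] -/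
theorem far_majorant_le {X T₀ V R : ℝ} (hX : 0 ≤ X) (hV : 0 < V) (hT₀ : 0 < T₀) (hR : T₀ / 4 ≤ R)
    {y : ℝ} (hy : R < |y - T₀|) :
    (hardyZ y) ^ 2 * ‖plateauMollifier X (1 / 2 + y * I)‖ ^ 2 * Real.exp (-(y - T₀) ^ 2 / (V ^ 2 / 2)) ≤
      (10 ^ 8 * X * (1 + V) ^ 6 * Real.exp (-(R ^ 2) / V ^ 2)) * Real.exp (-(y - T₀) ^ 2 / (2 * V ^ 2)) := by
  set w := y - T₀ with hw
  have hZ : (hardyZ y) ^ 2 ≤ ((3 + |y|) ^ 3) ^ 2 := by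
    have h := norm_zeta_half_le y
    rw [← abs_hardyZ_eq_norm_riemannZeta_holds y] at h
    calc hardyZ y ^ 2 = |hardyZ y| ^ 2 := (sq_abs _).symm
      _ ≤ ((3 + |y|) ^ 3) ^ 2 := pow_le_pow_left₀ (abs_nonneg _) h 2
  have hψ : ‖plateauMollifier X (1 / 2 + y * I)‖ ^ 2 ≤ 4 * X := by
    have h := norm_plateauMollifier_half_le hX y
    calc ‖plateauMollifier X (1 / 2 + y * I)‖ ^ 2 ≤ (2 * Real.sqrt X) ^ 2 := pow_le_pow_left₀ (norm_nonneg _) h 2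
      _ = 4 * X := by rw [mul_pow, Real.sq_sqrt hX]; ring
  -- `3 + |y| ≤ 5 (1 + |w|)` since `|y| ≤ T₀ + |w| ≤ 5|w|`
  have hy5 : 3 + |y| ≤ 5 * (1 + |w|) := by
    have h1 : |y| ≤ |T₀| + |w| := by
      have := abs_add_le T₀ (y - T₀); rw [add_sub_cancel] at this; rwa [hw]
    rw [abs_of_pos hT₀] at h1
    have h2 : T₀ ≤ 4 * |w| := by linarith
    linarith
  have hpoly : ((3 + |y|) ^ 3) ^ 2 ≤ 5 ^ 6 * (1 + |w|) ^ 6 := by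
    rw [← pow_mul, show 3 * 2 = 6 by norm_num, ← mul_pow]
    exact pow_le_pow_left₀ (by positivity) hy5 6
  -- split the Gaussian: `e^{−2w²/V²} = e^{−w²/(2V²)} · e^{−w²/(2V²)} · e^{−w²/V²}` and `w² > R²`
  have hsplit : Real.exp (-(y - T₀) ^ 2 / (V ^ 2 / 2)) =
      Real.exp (-(w ^ 2) / (2 * V ^ 2)) * Real.exp (-(w ^ 2) / (2 * V ^ 2)) * Real.exp (-(w ^ 2) / V ^ 2) := by
    rw [← Real.exp_add, ← Real.exp_add, hw]; congr 1; field_simp; ring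
  have hwR : Real.exp (-(w ^ 2) / V ^ 2) ≤ Real.exp (-(R ^ 2) / V ^ 2) := by
    refine Real.exp_le_exp.2 (div_le_div_of_nonneg_right ?_ (by positivity))
    have hR0 : 0 ≤ R := by linarith
    have : R ^ 2 ≤ w ^ 2 := by
      rw [← sq_abs w]; exact pow_le_pow_left₀ hR0 hy.le 2
    linarith
  have hg6 := one_add_abs_pow_six_mul_exp_le (w := w) hV
  have hZψ : hardyZ y ^ 2 * ‖plateauMollifier X (1 / 2 + y * I)‖ ^ 2 ≤ (5 ^ 6 * (1 + |w|) ^ 6) * (4 * X) :=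
    mul_le_mul (hZ.trans hpoly) hψ (by positivity) (by positivity)
  rw [hsplit]
  have e0 : 0 ≤ Real.exp (-(w ^ 2) / (2 * V ^ 2)) := (Real.exp_pos _).le
  calc hardyZ y ^ 2 * ‖plateauMollifier X (1 / 2 + y * I)‖ ^ 2 *
        (Real.exp (-(w ^ 2) / (2 * V ^ 2)) * Real.exp (-(w ^ 2) / (2 * V ^ 2)) * Real.exp (-(w ^ 2) / V ^ 2))
      ≤ ((5 ^ 6 * (1 + |w|) ^ 6) * (4 * X)) *
        (Real.exp (-(w ^ 2) / (2 * V ^ 2)) * Real.exp (-(w ^ 2) / (2 * V ^ 2)) * Real.exp (-(R ^ 2) / V ^ 2)) := by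
        refine mul_le_mul hZψ ?_ (by positivity) (by positivity)
        exact mul_le_mul_of_nonneg_left hwR (by positivity)
    _ = 4 * 5 ^ 6 * X * ((1 + |w|) ^ 6 * Real.exp (-(w ^ 2) / (2 * V ^ 2))) * Real.exp (-(R ^ 2) / V ^ 2)
        * Real.exp (-(w ^ 2) / (2 * V ^ 2)) := by ring
    _ ≤ 4 * 5 ^ 6 * X * (1568 * (1 + V) ^ 6) * Real.exp (-(R ^ 2) / V ^ 2) * Real.exp (-(w ^ 2) / (2 * V ^ 2)) := by
        gcongr
    _ ≤ _ := by
        rw [hw]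
        have : 0 ≤ X * (1 + V) ^ 6 * Real.exp (-(R ^ 2) / V ^ 2) * Real.exp (-((y - T₀) ^ 2) / (2 * V ^ 2)) := by
          positivity
        rw [show -(y - T₀) ^ 2 / (2 * V ^ 2) = -((y - T₀) ^ 2) / (2 * V ^ 2) by ring]
        nlinarith

/-! ### `J(1/2)`: the error expression of Lemma 9.23/§9.24 at comparable heights -/

/-- The error expression `E(T, X, U, ε)` of `mollified_meanSquare_le` is, for `T₀/2 ≤ a ≤ 3T₀/2`,
at most `3 E(T₀, X, U, ε)` (with the same `U`). [folklore] -/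
theorem errExpr_le_three_mul {T₀ a X U ε : ℝ} (hT₀ : 2 ≤ T₀) (ha1 : T₀ / 2 ≤ a) (ha2 : a ≤ 3 * T₀ / 2)
    (hX : 1 ≤ X) (hU : 0 ≤ U) (hε : 0 < ε) :
    a ^ (9 / 10 : ℝ) + X ^ (3 / 2 : ℝ) * Real.sqrt a * (1 + Real.log a) ^ 2
        + Real.sqrt X * U ^ 2 / a + X * U / Real.sqrt a
        + ε * U * (1 + Real.log a) + ε⁻¹ * (1 + U / Real.sqrt a + U ^ 2 / a) ≤
      3 * (T₀ ^ (9 / 10 : ℝ) + X ^ (3 / 2 : ℝ) * Real.sqrt T₀ * (1 + Real.log T₀) ^ 2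
        + Real.sqrt X * U ^ 2 / T₀ + X * U / Real.sqrt T₀
        + ε * U * (1 + Real.log T₀) + ε⁻¹ * (1 + U / Real.sqrt T₀ + U ^ 2 / T₀)) := by
  have hT0 : 0 < T₀ := by linarith
  have ha0 : 0 < a := by linarith
  have hsT : 0 < Real.sqrt T₀ := Real.sqrt_pos.2 hT0
  have hsa : 0 < Real.sqrt a := Real.sqrt_pos.2 ha0
  have hlogT : 0 ≤ Real.log T₀ := Real.log_nonneg (by linarith)
  have hloga0 : 0 ≤ Real.log a := Real.log_nonneg (by linarith)
  -- comparisons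
  have h1 : a ^ (9 / 10 : ℝ) ≤ 2 * T₀ ^ (9 / 10 : ℝ) := by
    have : a ≤ 2 * T₀ := by linarith
    calc a ^ (9 / 10 : ℝ) ≤ (2 * T₀) ^ (9 / 10 : ℝ) := Real.rpow_le_rpow ha0.le this (by norm_num)
      _ = 2 ^ (9 / 10 : ℝ) * T₀ ^ (9 / 10 : ℝ) := Real.mul_rpow (by norm_num) hT0.le
      _ ≤ 2 * T₀ ^ (9 / 10 : ℝ) := by
          refine mul_le_mul_of_nonneg_right ?_ (by positivity)
          calc (2 : ℝ) ^ (9 / 10 : ℝ) ≤ 2 ^ (1 : ℝ) := Real.rpow_le_rpow_of_exponent_le (by norm_num) (by norm_num)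
            _ = 2 := Real.rpow_one 2
  have h2 : Real.sqrt a ≤ 5 / 4 * Real.sqrt T₀ := by
    rw [show 5 / 4 * Real.sqrt T₀ = Real.sqrt (25 / 16 * T₀) by
      rw [Real.sqrt_mul (by norm_num), show (25 / 16 : ℝ) = (5 / 4) ^ 2 by norm_num, Real.sqrt_sq (by norm_num)]]
    exact Real.sqrt_le_sqrt (by linarith)
  have h3 : Real.log a ≤ Real.log T₀ + 1 / 2 := by
    have : Real.log a ≤ Real.log (3 / 2 * T₀) := Real.log_le_log ha0 (by linarith)
    rw [Real.log_mul (by norm_num) hT0.ne'] at this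
    have h32 : Real.log (3 / 2 : ℝ) ≤ 1 / 2 := by
      have := Real.log_le_sub_one_of_pos (show (0 : ℝ) < 3 / 2 by norm_num); linarith
    linarith
  have h4 : 1 / a ≤ 2 / T₀ := by rw [div_le_div_iff₀ ha0 hT0]; linarith
  have h5 : 1 / Real.sqrt a ≤ 3 / 2 / Real.sqrt T₀ := by
    rw [div_le_div_iff₀ hsa hsT]
    have : Real.sqrt T₀ ≤ Real.sqrt (2 * a) := Real.sqrt_le_sqrt (by linarith)
    rw [Real.sqrt_mul (by norm_num)] at this
    have hs2 : Real.sqrt 2 ≤ 3 / 2 := by rw [Real.sqrt_le_left (by norm_num)]; norm_num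
    nlinarith [Real.sqrt_nonneg a]
  have hla : 1 + Real.log a ≤ 3 / 2 * (1 + Real.log T₀) := by linarith
  have hla2 : (1 + Real.log a) ^ 2 ≤ 9 / 4 * (1 + Real.log T₀) ^ 2 := by
    have h0 : 0 ≤ 1 + Real.log a := by linarith
    nlinarith
  -- term by term
  have t2 : X ^ (3 / 2 : ℝ) * Real.sqrt a * (1 + Real.log a) ^ 2 ≤
      3 * (X ^ (3 / 2 : ℝ) * Real.sqrt T₀ * (1 + Real.log T₀) ^ 2) := by
    have hX32 : 0 ≤ X ^ (3 / 2 : ℝ) := by positivity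
    calc X ^ (3 / 2 : ℝ) * Real.sqrt a * (1 + Real.log a) ^ 2
        ≤ X ^ (3 / 2 : ℝ) * (5 / 4 * Real.sqrt T₀) * (9 / 4 * (1 + Real.log T₀) ^ 2) := by
          refine mul_le_mul (mul_le_mul_of_nonneg_left h2 hX32) hla2 (by positivity) (by positivity)
      _ = (45 / 16) * (X ^ (3 / 2 : ℝ) * Real.sqrt T₀ * (1 + Real.log T₀) ^ 2) := by ring
      _ ≤ _ := by
          have : 0 ≤ X ^ (3 / 2 : ℝ) * Real.sqrt T₀ * (1 + Real.log T₀) ^ 2 := by positivity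
          nlinarith
  have t3 : Real.sqrt X * U ^ 2 / a ≤ 3 * (Real.sqrt X * U ^ 2 / T₀) := by
    have h0 : 0 ≤ Real.sqrt X * U ^ 2 := by positivity
    calc Real.sqrt X * U ^ 2 / a = Real.sqrt X * U ^ 2 * (1 / a) := by ring
      _ ≤ Real.sqrt X * U ^ 2 * (2 / T₀) := mul_le_mul_of_nonneg_left h4 h0
      _ ≤ 3 * (Real.sqrt X * U ^ 2 / T₀) := by
          rw [show Real.sqrt X * U ^ 2 * (2 / T₀) = 2 * (Real.sqrt X * U ^ 2 / T₀) by ring]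
          have : 0 ≤ Real.sqrt X * U ^ 2 / T₀ := by positivity
          nlinarith
  have t4 : X * U / Real.sqrt a ≤ 3 * (X * U / Real.sqrt T₀) := by
    have h0 : 0 ≤ X * U := by positivity
    calc X * U / Real.sqrt a = X * U * (1 / Real.sqrt a) := by ring
      _ ≤ X * U * (3 / 2 / Real.sqrt T₀) := mul_le_mul_of_nonneg_left h5 h0
      _ ≤ 3 * (X * U / Real.sqrt T₀) := by
          rw [show X * U * (3 / 2 / Real.sqrt T₀) = 3 / 2 * (X * U / Real.sqrt T₀) by ring]
          have : 0 ≤ X * U / Real.sqrt T₀ := by positivity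
          nlinarith
  have t5 : ε * U * (1 + Real.log a) ≤ 3 * (ε * U * (1 + Real.log T₀)) := by
    have h0 : 0 ≤ ε * U := by positivity
    have := mul_le_mul_of_nonneg_left hla h0
    have : 0 ≤ ε * U * (1 + Real.log T₀) := by positivity
    nlinarith
  have t6 : ε⁻¹ * (1 + U / Real.sqrt a + U ^ 2 / a) ≤ 3 * (ε⁻¹ * (1 + U / Real.sqrt T₀ + U ^ 2 / T₀)) := by
    have hi : 0 < ε⁻¹ := by positivity
    have q1 : U / Real.sqrt a ≤ 3 / 2 * (U / Real.sqrt T₀) := by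
      calc U / Real.sqrt a = U * (1 / Real.sqrt a) := by ring
        _ ≤ U * (3 / 2 / Real.sqrt T₀) := mul_le_mul_of_nonneg_left h5 hU
        _ = _ := by ring
    have q2 : U ^ 2 / a ≤ 2 * (U ^ 2 / T₀) := by
      calc U ^ 2 / a = U ^ 2 * (1 / a) := by ring
        _ ≤ U ^ 2 * (2 / T₀) := mul_le_mul_of_nonneg_left h4 (sq_nonneg U)
        _ = _ := by ring
    have hB : 1 + U / Real.sqrt a + U ^ 2 / a ≤ 3 * (1 + U / Real.sqrt T₀ + U ^ 2 / T₀) := by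
      have : 0 ≤ U / Real.sqrt T₀ := by positivity
      have : 0 ≤ U ^ 2 / T₀ := by positivity
      linarith
    calc ε⁻¹ * (1 + U / Real.sqrt a + U ^ 2 / a) ≤ ε⁻¹ * (3 * (1 + U / Real.sqrt T₀ + U ^ 2 / T₀)) :=
          mul_le_mul_of_nonneg_left hB hi.le
      _ = _ := by ring
  have hT9 : 0 ≤ T₀ ^ (9 / 10 : ℝ) := by positivity
  linarith

/-- The main-term comparison: `U (1 + log a/log X) ≤ 2 U (1 + log T₀/log X)` for `a ≤ 3T₀/2`,
`X ≥ 3`. [folklore] -/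
theorem mainExpr_le_two_mul {T₀ a X U : ℝ} (hT₀ : 2 ≤ T₀) (ha0 : 1 ≤ a) (ha2 : a ≤ 3 * T₀ / 2)
    (hX : 3 ≤ X) (hU : 0 ≤ U) :
    U * (1 + Real.log a / Real.log X) ≤ 2 * (U * (1 + Real.log T₀ / Real.log X)) := by
  have hT0 : 0 < T₀ := by linarith
  have hLX : 1 ≤ Real.log X := by
    rw [Real.le_log_iff_exp_le (by linarith)]; have := Real.exp_one_lt_d9; linarith
  have hlogT : 0 ≤ Real.log T₀ := Real.log_nonneg (by linarith)
  have h3 : Real.log a ≤ Real.log T₀ + 1 / 2 := by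
    have : Real.log a ≤ Real.log (3 / 2 * T₀) := Real.log_le_log (by linarith) (by linarith)
    rw [Real.log_mul (by norm_num) hT0.ne'] at this
    have h32 : Real.log (3 / 2 : ℝ) ≤ 1 / 2 := by
      have := Real.log_le_sub_one_of_pos (show (0 : ℝ) < 3 / 2 by norm_num); linarith
    linarith
  have hq : Real.log a / Real.log X ≤ Real.log T₀ / Real.log X + 1 / 2 := by
    have h0 : 0 < Real.log X := by linarith
    calc Real.log a / Real.log X ≤ (Real.log T₀ + 1 / 2) / Real.log X :=
          div_le_div_of_nonneg_right h3 h0.le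
      _ = Real.log T₀ / Real.log X + (1 / 2) / Real.log X := by ring
      _ ≤ Real.log T₀ / Real.log X + 1 / 2 := by
          have : (1 / 2) / Real.log X ≤ 1 / 2 := div_le_self (by norm_num) hLX
          linarith
  have hr : 0 ≤ Real.log T₀ / Real.log X := by positivity
  nlinarith

/-! ### `J(1/2)`: the block decomposition of the near integral -/

/-- `e^{-2} ≤ 1/7`. [folklore] -/
theorem exp_neg_two_le : Real.exp (-2) ≤ 1 / 7 := by
  rw [Real.exp_neg, inv_eq_one_div, div_le_div_iff₀ (Real.exp_pos _) (by norm_num), one_mul, one_mul]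
  have h : Real.exp 2 = Real.exp 1 * Real.exp 1 := by rw [← Real.exp_add]; norm_num
  rw [h]
  have he := Real.exp_one_gt_d9
  nlinarith

/-- `∑_{m < K} e^{-2m} ≤ 7/6`. [folklore] -/
theorem sum_range_exp_neg_two_mul_le (K : ℕ) :
    ∑ m ∈ Finset.range K, Real.exp (-2 * m) ≤ 7 / 6 := by
  have hx0 : 0 ≤ Real.exp (-2) := (Real.exp_pos _).le
  have hx1 : Real.exp (-2) < 1 := by have := exp_neg_two_le; linarith
  have h := geom_sum_Ico_le_of_lt_one (m := 0) (n := K) hx0 hx1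
  rw [pow_zero, ← Finset.range_eq_Ico] at h
  have heq : ∀ m : ℕ, Real.exp (-2 * m) = Real.exp (-2) ^ m := by
    intro m; rw [← Real.exp_nat_mul]; ring_nf
  simp_rw [heq]
  refine h.trans ?_
  have := exp_neg_two_le
  rw [div_le_div_iff₀ (by linarith) (by norm_num)]
  linarith

/-- **The near integral, block by block.** If `f ≥ 0` is continuous and every block integral
`∫_{T₀ − KV + jV}^{T₀ − KV + (j+1)V} f ≤ B` (`j < 2K`), then
`∫_{T₀−KV}^{T₀+KV} f(y) e^{-2(y−T₀)²/V²} dy ≤ (7/3) B` (the Gaussian is `≤ e^{-2m_j²} ≤ e^{-2m_j}`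
on the `j`-th block, `m_j` its distance to `T₀` in units of `V`). [folklore] -/
theorem near_integral_le {f : ℝ → ℝ} (hf : Continuous f) (hf0 : ∀ y, 0 ≤ f y) {T₀ V : ℝ} (hV : 0 < V)
    (K : ℕ) {B : ℝ} (hB : 0 ≤ B)
    (hblock : ∀ j : ℕ, j < 2 * K →
      ∫ y in (T₀ - K * V + j * V)..(T₀ - K * V + (j + 1) * V), f y ≤ B) :
    ∫ y in (T₀ - K * V)..(T₀ + K * V), f y * Real.exp (-(y - T₀) ^ 2 / (V ^ 2 / 2)) ≤ 7 / 3 * B := by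
  set a : ℕ → ℝ := fun j => T₀ - K * V + j * V with ha
  set g : ℝ → ℝ := fun y => Real.exp (-(y - T₀) ^ 2 / (V ^ 2 / 2)) with hg
  have hcont : Continuous fun y => f y * g y :=
    hf.mul (Real.continuous_exp.comp (((continuous_id.sub continuous_const).pow 2).neg.div_const _))
  have ha0 : a 0 = T₀ - K * V := by simp [ha]
  have ha2K : a (2 * K) = T₀ + K * V := by simp [ha]; ring
  have hii : ∀ k < 2 * K, IntervalIntegrable (fun y => f y * g y) MeasureTheory.volume (a k) (a (k + 1)) :=
    fun k _ => hcont.intervalIntegrable (a k) (a (k + 1))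
  have hsum := intervalIntegral.sum_integral_adjacent_intervals hii
  rw [ha0, ha2K] at hsum
  rw [← hsum]
  -- distance index and the per-block bound
  set m : ℕ → ℕ := fun j => if j < K then K - 1 - j else j - K with hm
  have hper : ∀ j < 2 * K, ∫ y in a j..a (j + 1), f y * g y ≤ B * Real.exp (-2 * (m j : ℝ)) := by
    intro j hj
    have hajle : a j ≤ a (j + 1) := by simp [ha]; nlinarith
    -- on the block, `g ≤ e^{-2 m_j}`
    have hgle : ∀ y ∈ Set.Icc (a j) (a (j + 1)), g y ≤ Real.exp (-2 * (m j : ℝ)) := by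
      intro y hy
      have hdist : ((m j : ℕ) : ℝ) * V ≤ |y - T₀| := by
        simp only [hm]
        split_ifs with hjK
        · -- `y ≤ a (j+1) = T₀ − (K − 1 − j) V`
          have h2 : y ≤ a (j + 1) := hy.2
          simp only [ha] at h2
          have hc : ((K - 1 - j : ℕ) : ℝ) = (K : ℝ) - 1 - j := by
            rw [Nat.cast_sub (by omega), Nat.cast_sub (by omega)]; push_cast; ring
          rw [hc]
          have : T₀ - y ≥ ((K : ℝ) - 1 - j) * V := by push_cast at h2; nlinarith
          have hnn : 0 ≤ ((K : ℝ) - 1 - j) * V := by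
            have : (j : ℝ) + 1 ≤ K := by exact_mod_cast hjK
            nlinarith
          rw [abs_sub_comm, abs_of_nonneg (by linarith)]
          linarith
        · have h1 : a j ≤ y := hy.1
          simp only [ha] at h1
          have hc : ((j - K : ℕ) : ℝ) = (j : ℝ) - K := by rw [Nat.cast_sub (by omega)]
          rw [hc]
          have : y - T₀ ≥ ((j : ℝ) - K) * V := by nlinarith
          have hnn : 0 ≤ ((j : ℝ) - K) * V := by
            have : (K : ℝ) ≤ j := by exact_mod_cast (not_lt.1 hjK)
            nlinarith
          rw [abs_of_nonneg (by linarith)]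
          linarith
      have hsq : ((m j : ℝ) * V) ^ 2 ≤ (y - T₀) ^ 2 := by
        rw [← sq_abs (y - T₀)]; exact pow_le_pow_left₀ (by positivity) hdist 2
      simp only [hg]
      refine Real.exp_le_exp.2 ?_
      have hV2 : 0 < V ^ 2 / 2 := by positivity
      -- `−(y−T₀)²/(V²/2) ≤ −2 m² ≤ −2 m`
      have h1 : -(y - T₀) ^ 2 / (V ^ 2 / 2) ≤ -2 * (m j : ℝ) ^ 2 := by
        rw [div_le_iff₀ hV2]
        have : ((m j : ℝ) * V) ^ 2 = (m j : ℝ) ^ 2 * V ^ 2 := by ring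
        nlinarith
      have h2 : (m j : ℝ) ≤ (m j : ℝ) ^ 2 := by
        rcases Nat.eq_zero_or_pos (m j) with h0 | hpos
        · simp [h0]
        · have : (1 : ℝ) ≤ m j := by exact_mod_cast hpos
          nlinarith
      exact h1.trans (by linarith)
    calc ∫ y in a j..a (j + 1), f y * g y ≤ ∫ y in a j..a (j + 1), f y * Real.exp (-2 * (m j : ℝ)) := by
          refine intervalIntegral.integral_mono_on hajle (hcont.intervalIntegrable _ _)
            ((hf.mul continuous_const).intervalIntegrable _ _) fun y hy => ?_
          exact mul_le_mul_of_nonneg_left (hgle y hy) (hf0 y)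
      _ = (∫ y in a j..a (j + 1), f y) * Real.exp (-2 * (m j : ℝ)) := intervalIntegral.integral_mul_const _ _
      _ ≤ B * Real.exp (-2 * (m j : ℝ)) := by
          refine mul_le_mul_of_nonneg_right ?_ (Real.exp_pos _).le
          have := hblock j hj
          simp only [ha]; push_cast; exact this
  -- sum over the blocks
  calc ∑ k ∈ Finset.range (2 * K), ∫ y in a k..a (k + 1), f y * g y
      ≤ ∑ k ∈ Finset.range (2 * K), B * Real.exp (-2 * (m k : ℝ)) :=
        Finset.sum_le_sum fun k hk => hper k (Finset.mem_range.1 hk)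
    _ = B * ∑ k ∈ Finset.range (2 * K), Real.exp (-2 * (m k : ℝ)) := by rw [Finset.mul_sum]
    _ ≤ B * (7 / 3) := by
        refine mul_le_mul_of_nonneg_left ?_ hB
        -- split the range at `K` and reindex both halves to `∑_{i<K} e^{-2i}`
        rw [Finset.range_eq_Ico, ← Finset.sum_Ico_consecutive _ (Nat.zero_le K) (by omega : K ≤ 2 * K)]
        have h1 : ∑ k ∈ Finset.Ico 0 K, Real.exp (-2 * (m k : ℝ)) = ∑ i ∈ Finset.range K, Real.exp (-2 * (i : ℝ)) := by
          rw [← Finset.range_eq_Ico, ← Finset.sum_range_reflect]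
          refine Finset.sum_congr rfl fun k hk => ?_
          have hkK : k < K := Finset.mem_range.1 hk
          have e : m (K - 1 - k) = k := by simp only [hm]; rw [if_pos (by omega)]; omega
          rw [e]
        have h2 : ∑ k ∈ Finset.Ico K (2 * K), Real.exp (-2 * (m k : ℝ)) = ∑ i ∈ Finset.range K, Real.exp (-2 * (i : ℝ)) := by
          rw [Finset.sum_Ico_eq_sum_range, show 2 * K - K = K by omega]
          refine Finset.sum_congr rfl fun i _ => ?_
          have e : m (K + i) = i := by simp only [hm]; rw [if_neg (by omega)]; omega
          rw [e]
        rw [h1, h2]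
        have := sum_range_exp_neg_two_mul_le K
        linarith
    _ = 7 / 3 * B := by ring

/-! ### `J(1/2) ≪ V log T₀/log X`: assembly -/

/-- Continuity of `y ↦ Z(y)² |ψ_X(1/2+iy)|²`. [folklore] -/
theorem continuous_Zsq_normSq_psi (X : ℝ) :
    Continuous fun y : ℝ => (hardyZ y) ^ 2 * ‖plateauMollifier X (1 / 2 + y * I)‖ ^ 2 := by
  refine (continuous_hardyZ.pow 2).mul ?_
  refine ((differentiable_plateauMollifier X).continuous.comp ?_).norm.pow 2
  exact continuous_const.add (Complex.continuous_ofReal.mul continuous_const)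

/-- Continuity of `y ↦ G(1/2+iy)`. [folklore] -/
theorem continuous_zetaMollifierG_half (X T₀ V : ℝ) :
    Continuous fun y : ℝ => zetaMollifierG X T₀ V ((1 / 2 : ℝ) + y * I) := by
  refine (differentiableOn_zetaMollifierG X T₀ V).continuousOn.comp_continuous
    (continuous_const.add (Complex.continuous_ofReal.mul continuous_const)) fun y => ?_
  simp only [Set.mem_setOf_eq]; simp; norm_num

set_option maxHeartbeats 1600000 in
/-- **`J(1/2)`, the Gaussian-weighted mollified mean square on the critical line** (Selberg;
Titchmarsh §9.24 "`∫_T^{T+U} |ζψ|² dt = O(U log T/log X)`"): there are `C₅ > 0` and `t₅` such that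
for `t₅ ≤ T₀/2`, `3 ≤ X`, `4X ≤ ⌊(T₀/4π)^{1/2}⌋`, `3 ≤ V ≤ T₀/4`, `0 < ε ≤ 1`,
`∫ |G_{X,T₀,V}(1/2+iy)|² dy ≤ C₅ {V(1 + log T₀/log X) + X E(T₀,X,V,ε) + X(1+V)⁷ e^{-(T₀/4V)²} + V}`
(`E` the error expression of `mollified_meanSquare_le`; blocks of length `V` around `T₀`, the
polynomial growth of `ζ` against the Gaussian elsewhere). [cite: Titchmarsh1986, §9.24] -/
theorem meanSquare_zetaMollifierG_half_le : ∃ C₅ t₅ : ℝ, 0 < C₅ ∧ 400 ≤ t₅ ∧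
    ∀ (T₀ X V ε : ℝ), t₅ ≤ T₀ / 2 → 3 ≤ X → 4 * X ≤ (⌊Real.sqrt (T₀ / (4 * π))⌋₊ : ℝ) →
      3 ≤ V → V ≤ T₀ / 4 → 0 < ε → ε ≤ 1 →
    ∫ y : ℝ, ‖zetaMollifierG X T₀ V ((1 / 2 : ℝ) + y * I)‖ ^ 2 ≤
      C₅ * (V * (1 + Real.log T₀ / Real.log X)
        + X * (T₀ ^ (9 / 10 : ℝ) + X ^ (3 / 2 : ℝ) * Real.sqrt T₀ * (1 + Real.log T₀) ^ 2
            + Real.sqrt X * V ^ 2 / T₀ + X * V / Real.sqrt T₀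
            + ε * V * (1 + Real.log T₀) + ε⁻¹ * (1 + V / Real.sqrt T₀ + V ^ 2 / T₀))
        + X * (1 + V) ^ 7 * Real.exp (-(T₀ / (4 * V)) ^ 2) + V) := by
  obtain ⟨C₄, t₉, hC₄, ht₉, h924⟩ := mollified_meanSquare_le
  refine ⟨14 * C₄ + 10 ^ 9, t₉, by positivity, ht₉, ?_⟩
  intro T₀ X V ε hT hX h4X hV hVT hε hε1
  have hT800 : (800 : ℝ) ≤ T₀ := by linarith
  have hT0 : 0 < T₀ := by linarith
  have hV0 : 0 < V := by linarith
  have hX0 : 0 ≤ X := by linarith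
  have hX1 : 1 ≤ X := by linarith
  have hLT : 0 ≤ Real.log T₀ := Real.log_nonneg (by linarith)
  have hLX : 1 ≤ Real.log X := by
    rw [Real.le_log_iff_exp_le (by linarith)]; have := Real.exp_one_lt_d9; linarith
  -- the error expression at `T₀`
  set E₀ := T₀ ^ (9 / 10 : ℝ) + X ^ (3 / 2 : ℝ) * Real.sqrt T₀ * (1 + Real.log T₀) ^ 2
      + Real.sqrt X * V ^ 2 / T₀ + X * V / Real.sqrt T₀
      + ε * V * (1 + Real.log T₀) + ε⁻¹ * (1 + V / Real.sqrt T₀ + V ^ 2 / T₀) with hE₀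
  have hE₀0 : 0 ≤ E₀ := by rw [hE₀]; positivity
  set M₀ := V * (1 + Real.log T₀ / Real.log X) with hM₀
  have hM₀0 : 0 ≤ M₀ := by rw [hM₀]; positivity
  -- blocks: `K = ⌊T₀/(2V)⌋`, `R = K V ∈ [T₀/4, T₀/2]`
  set K := ⌊T₀ / (2 * V)⌋₊ with hKdef
  have hKle : (K : ℝ) ≤ T₀ / (2 * V) := Nat.floor_le (by positivity)
  have hKgt : T₀ / (2 * V) - 1 < K := by
    have := Nat.lt_floor_add_one (T₀ / (2 * V)); rw [← hKdef] at this; linarith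
  set R := (K : ℝ) * V with hRdef
  have hR1 : R ≤ T₀ / 2 := by
    calc R = (K : ℝ) * V := rfl
      _ ≤ T₀ / (2 * V) * V := mul_le_mul_of_nonneg_right hKle hV0.le
      _ = T₀ / 2 := by field_simp
  have hR2 : T₀ / 4 ≤ R := by
    have h1 : (T₀ / (2 * V) - 1) * V ≤ R := (mul_le_mul_of_nonneg_right hKgt.le hV0.le)
    have e : (T₀ / (2 * V) - 1) * V = T₀ / 2 - V := by field_simp
    rw [e] at h1; linarith
  -- the players
  set f : ℝ → ℝ := fun y => (hardyZ y) ^ 2 * ‖plateauMollifier X (1 / 2 + y * I)‖ ^ 2 with hf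
  set g : ℝ → ℝ := fun y => Real.exp (-(y - T₀) ^ 2 / (V ^ 2 / 2)) with hg
  set A := 10 ^ 8 * X * (1 + V) ^ 6 * Real.exp (-(R ^ 2) / V ^ 2) with hA
  have hA0 : 0 ≤ A := by rw [hA]; positivity
  set Ff : ℝ → ℝ := fun y => A * Real.exp (-(y - T₀) ^ 2 / (2 * V ^ 2)) with hFf
  have hfc : Continuous f := continuous_Zsq_normSq_psi X
  have hf0 : ∀ y, 0 ≤ f y := fun y => by simp only [hf]; positivity
  have hgc : Continuous g :=
    Real.continuous_exp.comp (((continuous_id.sub continuous_const).pow 2).neg.div_const _)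
  have hg0 : ∀ y, 0 ≤ g y := fun y => (Real.exp_pos _).le
  -- pointwise majorant of `|G(1/2+iy)|²`
  have hpt : ∀ y : ℝ, ‖zetaMollifierG X T₀ V ((1 / 2 : ℝ) + y * I)‖ ^ 2 ≤
      2 * (Set.indicator (Set.Icc (T₀ - R) (T₀ + R)) (fun y => f y * g y) y + Ff y) + 2 * g y := by
    intro y
    have h1 := norm_sq_zetaMollifierG_half_le (X := X) (T₀ := T₀) hV0 y
    have hfg : f y * g y ≤ Set.indicator (Set.Icc (T₀ - R) (T₀ + R)) (fun y => f y * g y) y + Ff y := by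
      by_cases hy : y ∈ Set.Icc (T₀ - R) (T₀ + R)
      · rw [Set.indicator_of_mem hy]
        have : 0 ≤ Ff y := by simp only [hFf]; positivity
        linarith
      · rw [Set.indicator_of_notMem hy, zero_add]
        have hyR : R < |y - T₀| := by
          rw [Set.mem_Icc, not_and_or, not_le, not_le] at hy
          rcases hy with h | h
          · rw [abs_of_neg (by linarith)]; linarith
          · rw [abs_of_pos (by linarith)]; linarith
        have := far_majorant_le (X := X) (V := V) hX0 hV0 hT0 hR2 hyR
        simp only [hf, hg, hFf, hA]
        exact this
    have e : 2 * ((hardyZ y) ^ 2 * ‖plateauMollifier X (1 / 2 + y * I)‖ ^ 2 + 1) *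
        Real.exp (-(y - T₀) ^ 2 / (V ^ 2 / 2)) = 2 * (f y * g y) + 2 * g y := by
      simp only [hf, hg]; ring
    rw [e] at h1
    linarith
  -- integrability
  have hIfg : Integrable (Set.indicator (Set.Icc (T₀ - R) (T₀ + R)) (fun y => f y * g y)) :=
    ((hfc.mul hgc).continuousOn.integrableOn_Icc).integrable_indicator measurableSet_Icc
  have hIFf : Integrable Ff := by
    simp only [hFf]
    exact (integrable_exp_neg_sq_div (c := T₀) (by positivity : (0 : ℝ) < 2 * V ^ 2)).const_mul A
  have hIg : Integrable g := integrable_exp_neg_sq_div (c := T₀) (by positivity : (0 : ℝ) < V ^ 2 / 2)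
  have hImaj : Integrable fun y => 2 * (Set.indicator (Set.Icc (T₀ - R) (T₀ + R)) (fun y => f y * g y) y + Ff y) + 2 * g y :=
    ((hIfg.add hIFf).const_mul 2).add (hIg.const_mul 2)
  have hIG : Integrable fun y : ℝ => ‖zetaMollifierG X T₀ V ((1 / 2 : ℝ) + y * I)‖ ^ 2 := by
    refine hImaj.mono' (((continuous_zetaMollifierG_half X T₀ V).norm.pow 2).aestronglyMeasurable)
      (ae_of_all _ fun y => ?_)
    rw [Real.norm_eq_abs, abs_of_nonneg (by positivity)]
    exact hpt y
  -- the three integrals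
  -- (i) near part
  have hnear : ∫ y, Set.indicator (Set.Icc (T₀ - R) (T₀ + R)) (fun y => f y * g y) y ≤ 7 / 3 * (C₄ * (2 * M₀ + X * (3 * E₀))) := by
    rw [MeasureTheory.integral_indicator measurableSet_Icc, MeasureTheory.integral_Icc_eq_integral_Ioc,
      ← intervalIntegral.integral_of_le (by linarith : T₀ - R ≤ T₀ + R)]
    have hRK : T₀ - R = T₀ - K * V := by rw [hRdef]
    have hRK' : T₀ + R = T₀ + K * V := by rw [hRdef]
    rw [hRK, hRK']
    refine near_integral_le hfc hf0 hV0 K (by positivity) fun j hj => ?_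
    -- the block `[a, a + V]`, `a = T₀ − KV + jV ∈ [T₀/2, 3T₀/2 − V]`
    set a := T₀ - K * V + j * V with hadef
    have hj' : (j : ℝ) + 1 ≤ 2 * K := by exact_mod_cast hj
    have ha1 : T₀ / 2 ≤ a := by
      have : (0 : ℝ) ≤ j * V := by positivity
      rw [hadef]; rw [hRdef] at hR1; linarith
    have ha2 : a + V ≤ 3 * T₀ / 2 := by
      rw [hadef]
      have : (j : ℝ) * V + V ≤ 2 * K * V := by nlinarith
      rw [hRdef] at hR1; nlinarith
    have hat₉ : t₉ ≤ a := by linarith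
    have haV : a + V ≤ 2 * a := by linarith
    have hfloor : 4 * X ≤ (⌊Real.sqrt (a / (2 * π))⌋₊ : ℝ) := by
      refine h4X.trans ?_
      exact_mod_cast Nat.floor_mono (Real.sqrt_le_sqrt (by
        rw [div_le_div_iff₀ (by positivity) (by positivity)]; nlinarith [Real.pi_pos]))
    have hb := h924 a (a + V) X ε hat₉ (by linarith) haV hX hfloor hε hε1
    have e1 : T₀ - ↑K * V + (↑j + 1) * V = a + V := by rw [hadef]; ring
    rw [e1]
    have hfdef : ∀ y, f y = hardyZ y ^ 2 * ‖plateauMollifier X (1 / 2 + ↑y * I)‖ ^ 2 := fun y => rfl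
    simp only [hfdef]
    refine hb.trans ?_
    rw [show a + V - a = V by ring]
    have hmain := mainExpr_le_two_mul (T₀ := T₀) (a := a) (X := X) (U := V) (by linarith) (by linarith)
      (by linarith) hX hV0.le
    have herr := errExpr_le_three_mul (T₀ := T₀) (a := a) (X := X) (U := V) (ε := ε) (by linarith) ha1
      (by linarith) hX1 hV0.le hε
    rw [← hM₀] at hmain
    rw [← hE₀] at herr
    have hXE : X * (a ^ (9 / 10 : ℝ) + X ^ (3 / 2 : ℝ) * Real.sqrt a * (1 + Real.log a) ^ 2
        + Real.sqrt X * V ^ 2 / a + X * V / Real.sqrt a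
        + ε * V * (1 + Real.log a) + ε⁻¹ * (1 + V / Real.sqrt a + V ^ 2 / a)) ≤ X * (3 * E₀) :=
      mul_le_mul_of_nonneg_left herr hX0
    nlinarith [hC₄.le]
  -- (ii) far part
  have hfar : ∫ y, Ff y ≤ 10 ^ 9 / 3 * (X * (1 + V) ^ 7 * Real.exp (-(T₀ / (4 * V)) ^ 2)) := by
    simp only [hFf]
    rw [MeasureTheory.integral_const_mul, integral_exp_neg_sq_div (by positivity : (0 : ℝ) < 2 * V ^ 2)]
    have hs : Real.sqrt (π * (2 * V ^ 2)) = V * Real.sqrt (2 * π) := by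
      rw [show π * (2 * V ^ 2) = V ^ 2 * (2 * π) by ring, Real.sqrt_mul (sq_nonneg V), Real.sqrt_sq hV0.le]
    rw [hs]
    have h2π : Real.sqrt (2 * π) ≤ 2.51 := by
      rw [Real.sqrt_le_left (by norm_num)]; nlinarith [Real.pi_lt_d4]
    have hexpR : Real.exp (-(R ^ 2) / V ^ 2) ≤ Real.exp (-(T₀ / (4 * V)) ^ 2) := by
      refine Real.exp_le_exp.2 ?_
      rw [div_pow, neg_div, neg_le_neg_iff, div_le_div_iff₀ (by positivity) (by positivity)]
      have : (T₀ / 4) ^ 2 ≤ R ^ 2 := pow_le_pow_left₀ (by positivity) hR2 2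
      have hV2 : (4 * V) ^ 2 = 16 * V ^ 2 := by ring
      nlinarith [sq_nonneg V]
    have hV7 : (1 + V) ^ 6 * V ≤ (1 + V) ^ 7 := by
      rw [pow_succ]; exact mul_le_mul_of_nonneg_left (by linarith) (by positivity)
    rw [hA]
    have h0 : 0 ≤ X * (1 + V) ^ 7 * Real.exp (-(T₀ / (4 * V)) ^ 2) := by positivity
    calc 10 ^ 8 * X * (1 + V) ^ 6 * Real.exp (-(R ^ 2) / V ^ 2) * (V * Real.sqrt (2 * π))
        = 10 ^ 8 * X * ((1 + V) ^ 6 * V) * Real.exp (-(R ^ 2) / V ^ 2) * Real.sqrt (2 * π) := by ring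
      _ ≤ 10 ^ 8 * X * (1 + V) ^ 7 * Real.exp (-(T₀ / (4 * V)) ^ 2) * 2.51 := by
          gcongr
      _ ≤ _ := by nlinarith
  -- (iii) the pure Gaussian
  have hgint : ∫ y, g y ≤ 1.26 * V := by
    simp only [hg]
    rw [integral_exp_neg_sq_div (by positivity : (0 : ℝ) < V ^ 2 / 2)]
    have hs : Real.sqrt (π * (V ^ 2 / 2)) = V * Real.sqrt (π / 2) := by
      rw [show π * (V ^ 2 / 2) = V ^ 2 * (π / 2) by ring, Real.sqrt_mul (sq_nonneg V), Real.sqrt_sq hV0.le]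
    rw [hs]
    have := sqrt_pi_half_le.1
    nlinarith
  -- assemble
  calc ∫ y : ℝ, ‖zetaMollifierG X T₀ V ((1 / 2 : ℝ) + y * I)‖ ^ 2
      ≤ ∫ y, (2 * (Set.indicator (Set.Icc (T₀ - R) (T₀ + R)) (fun y => f y * g y) y + Ff y) + 2 * g y) :=
        integral_mono hIG hImaj hpt
    _ = 2 * ((∫ y, Set.indicator (Set.Icc (T₀ - R) (T₀ + R)) (fun y => f y * g y) y) + ∫ y, Ff y) + 2 * ∫ y, g y := by
        have h1 : Integrable (fun y => 2 * (Set.indicator (Set.Icc (T₀ - R) (T₀ + R)) (fun y => f y * g y) y + Ff y)) :=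
          (hIfg.add hIFf).const_mul 2
        have h2 : Integrable (fun y => 2 * g y) := hIg.const_mul 2
        have h3 : Integrable (fun y => Set.indicator (Set.Icc (T₀ - R) (T₀ + R)) (fun y => f y * g y) y) := hIfg
        rw [integral_add h1 h2, MeasureTheory.integral_const_mul, MeasureTheory.integral_const_mul,
          integral_add h3 hIFf]
    _ ≤ 2 * (7 / 3 * (C₄ * (2 * M₀ + X * (3 * E₀))) + 10 ^ 9 / 3 * (X * (1 + V) ^ 7 * Real.exp (-(T₀ / (4 * V)) ^ 2)))
        + 2 * (1.26 * V) := by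
        gcongr
    _ ≤ (14 * C₄ + 10 ^ 9) * (M₀ + X * E₀ + X * (1 + V) ^ 7 * Real.exp (-(T₀ / (4 * V)) ^ 2) + V) := by
        have h1 : 0 ≤ X * E₀ := by positivity
        have h2 : 0 ≤ X * (1 + V) ^ 7 * Real.exp (-(T₀ / (4 * V)) ^ 2) := by positivity
        nlinarith [mul_nonneg hC₄.le hM₀0, mul_nonneg hC₄.le h1, mul_nonneg hC₄.le h2, mul_nonneg hC₄.le hV0.le]

end Literature.NumberTheory.LFunctions.TwistedMoment
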